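import Summits.BirchSwinnertonDyer.BirchSwinnertonDyer.Theorems.CyclotomicUntwistSigmaLineFamilyBoundaryEvaluation
import Summits.BirchSwinnertonDyer.BirchSwinnertonDyer.Theorems.CyclotomicUntwistSigmaLineFamilyAdmissible
import Literature.NumberTheory.EllipticCurves.SigmaSqDivisionOfThetaProofs
import Literature.NumberTheory.EllipticCurves.FormalGroupMultiplication
import HarnessLib

/-!
# Route `CyclotomicUntwist`, crux K1 `PSRankOneLowerHalfAtThree` (stmt-BirchSwinnertonDyer-21580):
# the σ-LINE FAMILY — the SQUARED DIVISION IDENTITY of `σ_c` EVALUATED ON THE CLOSED DISC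
# `‖z‖ ≤ p⁻¹`: `σ_c(z(nP))² = σ_c(z(P))^{2n²} · ψₙ(P)²` at every admissible point (`p ≥ 3`)

Cell `pub/bsd-wall` (D-0145 line `route-BirchSwinnertonDyer-CyclotomicUntwist`), seat `bsd-line-cycu-p1`
g5, lane «σ-LINE FAMILY LAW — LEVEL-ONE DATUM», file 25 of the lane. THEOREMS ONLY (no definition, no
named fact, no `sorry`); helper `--supports` K1 = stmt-BirchSwinnertonDyer-21580. BSD is not proved by
this file and no crux is.

WHY. The census-facing ladder of the lane (memo `Cruxes/PSRankOneLowerHalfAtThree/SIGMA-LINE-FAMILY-LAW-v4`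
+ ADDENDUM-1) reads the bilinear σ_c-DATUM `D(P,P) = h_{σ_c}(P)` on the locus `v(z(P)) ≥ 2`
(`…LevelTwoDatum`), while the census predicate `CensusX42.IsTwistSigmaHeight` wants EVERY admissible
point (`v(z) ≥ 1`, the boundary `‖z‖ = p⁻¹` of Bernardi's disc, where no dilation makes `σ_c`
integral). The missing rung is the quasi-quadraticity `h_{σ_c}(pP) = p²·h_{σ_c}(P)` AT THE BOUNDARY,
whose analytic half is the content of this file: Mazur–Tate's squared division identity
`z^{2(n²−1)}·σ²([n]z) = σ(z)^{2n²}·z^{2(n²−1)}ψₙ²(x(z))` — a tree theorem for EVERY normalised odd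
solution of the sigma equation (`WeierstrassCurve.sigmaSqDivisionIdentity_sq_of_satisfiesSigmaODE`,
Mazur–Tate 1991 Thm. 3.1 / Silverman 2005 §5) — EVALUATED at a point `z` of the closed disc
`‖z‖ ≤ p⁻¹` by the lane's REARRANGEMENT THEOREM (`…BoundaryEvaluation.padicEval_subst_eq_tsum`,
absolute double summability with the `√p`-weights of `…SharpRadius`), and read at `z = z(P)`:

* §1 `norm_coeff_formalSigma_le_weighted`, `norm_coeff_formalSigma_sq_le` (`‖[tⁿ]σ_c²‖ ≤ p⁻¹·√pⁿ`),
  `padicEval_formalSigma_sq_of_norm_le` (`(σ_c²)(z) = σ_c(z)²`), `padicEval_X_pow`, the majorant `norm_term_subst_formalMul_le` and the absolute double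
  summability `summable_double_formalSigma_sq_formalMul` of `Σ_{d,m} [σ_c²]_d·[[n]^d]_m·z^m`;
* §2 **`padicEval_formalSigma_sq_subst_formalMul`** — `(σ_c² ∘ [n])(z) = σ_c([n](z))²` on `‖z‖ ≤ p⁻¹`;
  **`division_identity_at`** — `z^{2(n²−1)}·σ_c([n](z))² = σ_c(z)^{2n²}·Pₙ(z)` on `‖z‖ ≤ p⁻¹`;
* §3 **`padicEval_formalSigma_nsmul_sq`** — at a point `P = (x,y) ∈ E₁(ℚ_p)` (`‖x‖ > 1`):
  `σ_c(z(nP))² = σ_c(z(P))^{2n²}·ΨSqₙ(x)` (`[n](z(P)) = z(nP)`, `Pₙ(z(P)) = z^{2(n²−1)}ΨSqₙ(x)`), and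
  for `W/ℚ` globally minimal, `padicEval_formalSigma_nsmul_sq_rat`.

The arithmetic half (`den x(nP) = den x(P)^{n²}·ΨSqₙ(x)`, Literature
`DivisionValuesDenominatorLawProofs`) and the height law / level-one datum are the sequel
`…SigmaLineFamilyLevelOneDatum`.

References: Mazur–Tate 1991 Thm. 3.1; Silverman 2005 §5 Thm. 11 / Rem. 2; Bernardi 1981 §1; Robert 2000
Ch. V §4.2; Mazur–Stein–Tate 2006 §2. [cite: MazurTate1991, Thm. 3.1] [cite: Silverman2005DivPoly, §5
Thm. 11] [cite: Robert2000PadicAnalysis, Ch. V §4.2 Proposition 3] [cite: MazurSteinTate2006, §2.7]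
-/

set_option autoImplicit false
-- single-conjunct summit: `Summit.BirchSwinnertonDyer.BirchSwinnertonDyer.…` repeats the name by design
set_option linter.dupNamespace false

noncomputable section

open scoped Classical

open PowerSeries WeierstrassCurve Literature.NumberTheory.EllipticCurves Literature.RingTheory.FormalGroups

namespace Summit.BirchSwinnertonDyer.BirchSwinnertonDyer.Theorems.PSSigmaLineFamilyDivision

open Summit.BirchSwinnertonDyer.BirchSwinnertonDyer.Theorems.PSSigmaLineFamily
  Summit.BirchSwinnertonDyer.BirchSwinnertonDyer.Theorems.PSSigmaLineFamilyValues
  Summit.BirchSwinnertonDyer.BirchSwinnertonDyer.Theorems.PSSigmaLineFamilyEvaluation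
  Summit.BirchSwinnertonDyer.BirchSwinnertonDyer.Theorems.PSSigmaLineFamilySharpRadius
  Summit.BirchSwinnertonDyer.BirchSwinnertonDyer.Theorems.PSSigmaLineFamilyBoundaryEvaluation
  Summit.BirchSwinnertonDyer.BirchSwinnertonDyer.Theorems.PSSigmaLineFamilyAdmissible

/-! ### §1 Weights, squares and the double family -/

section Weights

variable {p : ℕ} [Fact p.Prime] (V : WeierstrassCurve ℚ_[p]) [V.IsIntegral ℤ_[p]]

/-- Bernardi's bound in weight form: `‖[tⁿ]σ_c‖ ≤ (√p)⁻¹·√pⁿ` for every `n` (`[t⁰]σ_c = 0`,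
`‖[t^{n+1}]σ_c‖ ≤ √pⁿ`). [Bernardi 1981, §1] [cite: MazurTate1991, Thm. 3.1] -/
theorem norm_coeff_formalSigma_le_weighted (hp : 3 ≤ p) {c : ℚ_[p]} (hc : ‖c‖ ≤ 1) (n : ℕ) :
    ‖coeff n (V.formalSigma c)‖ ≤ (√(p : ℝ))⁻¹ * √(p : ℝ) ^ n := by
  obtain ⟨-, hρ, -⟩ := one_le_sqrt_prime (p := p)
  rcases n with _ | n
  · rw [(norm_coeff_formalSigma_succ_le V hp hc 0).2, norm_zero]; positivity
  · calc ‖coeff (n + 1) (V.formalSigma c)‖ ≤ √(p : ℝ) ^ n := (norm_coeff_formalSigma_succ_le V hp hc n).1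
      _ = (√(p : ℝ))⁻¹ * √(p : ℝ) ^ (n + 1) := by
          rw [pow_succ, mul_comm _ (√(p : ℝ)), ← mul_assoc, inv_mul_cancel₀ hρ.ne', one_mul]

/-- `‖[tⁿ]σ_c²‖ ≤ p⁻¹·√pⁿ`. [Bernardi 1981, §1] [cite: MazurTate1991, Thm. 3.1] -/
theorem norm_coeff_formalSigma_sq_le (hp : 3 ≤ p) {c : ℚ_[p]} (hc : ‖c‖ ≤ 1) (n : ℕ) :
    ‖coeff n (V.formalSigma c ^ 2)‖ ≤ (p : ℝ)⁻¹ * √(p : ℝ) ^ n := by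
  obtain ⟨-, hρ, h2⟩ := one_le_sqrt_prime (p := p)
  have h := norm_coeff_pow_le_weighted (inv_nonneg.mpr hρ.le) hρ.le
    (norm_coeff_formalSigma_le_weighted V hp hc) 2 n
  rwa [inv_pow, h2] at h

/-- `Σ‖[σ_c²]ₙzⁿ‖ < ∞` and `(σ_c²)(z) = σ_c(z)²` on `‖z‖ ≤ p⁻¹`. [cite: Robert2000PadicAnalysis, Ch. V §4.2 Proposition 3] -/
theorem padicEval_formalSigma_sq_of_norm_le (hp : 3 ≤ p) {c : ℚ_[p]} (hc : ‖c‖ ≤ 1) {z : ℚ_[p]}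
    (hz : ‖z‖ ≤ (p : ℝ)⁻¹) :
    (Summable fun n : ℕ => ‖coeff n (V.formalSigma c ^ 2) * z ^ n‖) ∧
      padicEval (V.formalSigma c ^ 2) z = padicEval (V.formalSigma c) z ^ 2 :=
  padicEval_pow_of_summable_norm (summable_norm_formalSigma_of_norm_le V hp hc hz) 2

omit [V.IsIntegral ℤ_[p]] in
/-- `‖z‖ ≤ p⁻¹ ⇒ ‖z‖ < 1`. [folklore] -/
theorem norm_lt_one_of_norm_le_inv_prime {z : ℚ_[p]} (hz : ‖z‖ ≤ (p : ℝ)⁻¹) : ‖z‖ < 1 :=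
  hz.trans_lt (inv_lt_one_of_one_lt₀ (by exact_mod_cast (Fact.out : p.Prime).one_lt))

omit [V.IsIntegral ℤ_[p]] in
/-- `Σ‖[X^k]ₙzⁿ‖ < ∞` and `(X^k)(z) = z^k`. [folklore] -/
theorem padicEval_X_pow (z : ℚ_[p]) (k : ℕ) :
    (Summable fun n : ℕ => ‖coeff n ((X : ℚ_[p]⟦X⟧) ^ k) * z ^ n‖) ∧
      padicEval ((X : ℚ_[p]⟦X⟧) ^ k) z = z ^ k := by
  have hX : Summable fun n : ℕ => ‖coeff n (X : ℚ_[p]⟦X⟧) * z ^ n‖ := by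
    refine summable_of_ne_finset_zero (s := {1}) fun n hn => ?_
    rw [Finset.mem_singleton] at hn
    rw [coeff_X, if_neg hn, zero_mul, norm_zero]
  have h := padicEval_pow_of_summable_norm hX k
  rw [padicEval_X] at h
  exact h

/-- The majorant of the double family `T(d,m) = [σ_c²]_d·[[n]^d]_m·z^m`:
`‖T(d,m)‖ ≤ p⁻¹·G(d, 2m)` with `G` the majorant of `…BoundaryEvaluation` (`[[n]^d]_m = 0` for `m < d`,
`‖[[n]^d]_m‖ ≤ 1`, `‖[σ_c²]_d‖ ≤ p⁻¹√p^d`, `‖z‖^m ≤ p^{-m} = ((√p)⁻¹)^{2m}`). [folklore] -/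
theorem norm_term_subst_formalMul_le (hp : 3 ≤ p) {c : ℚ_[p]} (hc : ‖c‖ ≤ 1) {z : ℚ_[p]}
    (hz : ‖z‖ ≤ (p : ℝ)⁻¹) (n d m : ℕ) :
    ‖coeff d (V.formalSigma c ^ 2) * (coeff m (V.formalMul n ^ d) * z ^ m)‖ ≤
      (p : ℝ)⁻¹ * (if 2 * d ≤ 2 * m then √(p : ℝ) ^ d * ((√(p : ℝ))⁻¹) ^ (2 * m) else 0) := by
  obtain ⟨-, hρ, h2⟩ := one_le_sqrt_prime (p := p)
  split_ifs with hdm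
  · rw [norm_mul, norm_mul, norm_pow]
    have h1 := norm_coeff_formalSigma_sq_le V hp hc d
    have hint : ‖coeff m (V.formalMul n ^ d)‖ ≤ 1 :=
      isPadicInt_iff_coeff.mp ((V.isPadicInt_formalMul n).pow d) m
    have hsq : ((√(p : ℝ))⁻¹) ^ (2 * m) = ((p : ℝ)⁻¹) ^ m := by rw [pow_mul, inv_pow, h2]
    rw [hsq]
    calc ‖coeff d (V.formalSigma c ^ 2)‖ * (‖coeff m (V.formalMul n ^ d)‖ * ‖z‖ ^ m)
        ≤ ((p : ℝ)⁻¹ * √(p : ℝ) ^ d) * (1 * ((p : ℝ)⁻¹) ^ m) := by gcongr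
      _ = (p : ℝ)⁻¹ * (√(p : ℝ) ^ d * ((p : ℝ)⁻¹) ^ m) := by ring
  · rw [coeff_pow_eq_zero_of_lt (V.constantCoeff_formalMul n) (show m < d by omega), zero_mul,
      mul_zero, norm_zero, mul_zero]

/-- **Absolute double summability** of `Σ_{d,m} [σ_c²]_d·[[n]^d]_m·z^m` on `‖z‖ ≤ p⁻¹` (`p ≥ 3`,
`‖c‖ ≤ 1`): dominated by `p⁻¹·G(d,2m)`, `G` the summable majorant of `…BoundaryEvaluation`.
[cite: Robert2000PadicAnalysis, Ch. V §4.2 Proposition 3] -/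
theorem summable_double_formalSigma_sq_formalMul (hp : 3 ≤ p) {c : ℚ_[p]} (hc : ‖c‖ ≤ 1) {z : ℚ_[p]}
    (hz : ‖z‖ ≤ (p : ℝ)⁻¹) (n : ℕ) :
    Summable fun dm : ℕ × ℕ =>
      ‖coeff dm.1 (V.formalSigma c ^ 2) * (coeff dm.2 (V.formalMul n ^ dm.1) * z ^ dm.2)‖ := by
  have hinj : Function.Injective fun dm : ℕ × ℕ => (dm.1, 2 * dm.2) := by
    rintro ⟨d, m⟩ ⟨d', m'⟩ h
    simp only [Prod.mk.injEq] at h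
    exact Prod.ext h.1 (by omega)
  have hmaj := ((summable_majorant (p := p)).comp_injective hinj).mul_left (p : ℝ)⁻¹
  exact Summable.of_nonneg_of_le (fun _ => norm_nonneg _)
    (fun dm => norm_term_subst_formalMul_le V hp hc hz n dm.1 dm.2) hmaj

end Weights

/-! ### §2 The division identity on the closed disc -/

section Disc

variable {p : ℕ} [Fact p.Prime] (V : WeierstrassCurve ℚ_[p]) [V.IsIntegral ℤ_[p]]

omit [V.IsIntegral ℤ_[p]] in
/-- `[n]` maps the closed disc `‖z‖ ≤ p⁻¹` into itself (`[n]` integral, `[n](0) = 0`).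
[Silverman AEC IV.2.3] [cite: SilvermanAEC2009, IV.2.3] -/
theorem norm_padicEval_formalMul_le [V.IsIntegral ℤ_[p]] (n : ℕ) {z : ℚ_[p]} (hz : ‖z‖ ≤ (p : ℝ)⁻¹) :
    ‖padicEval (V.formalMul n) z‖ ≤ (p : ℝ)⁻¹ :=
  (norm_padicEval_le (V.isPadicInt_formalMul n) (V.constantCoeff_formalMul n)
    (norm_lt_one_of_norm_le_inv_prime hz)).trans hz

/-- **`(σ_c² ∘ [n])(z) = σ_c([n](z))²` on the closed disc `‖z‖ ≤ p⁻¹`** (`p ≥ 3`, `‖c‖ ≤ 1`), with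
absolute convergence of the substituted series — the rearrangement theorem for `f = σ_c²`, `g = [n]`.
[cite: Robert2000PadicAnalysis, Ch. V §4.2 Proposition 3] -/
theorem padicEval_formalSigma_sq_subst_formalMul (hp : 3 ≤ p) {c : ℚ_[p]} (hc : ‖c‖ ≤ 1)
    {z : ℚ_[p]} (hz : ‖z‖ ≤ (p : ℝ)⁻¹) (n : ℕ) :
    (Summable fun m : ℕ => ‖coeff m ((V.formalSigma c ^ 2).subst (V.formalMul n)) * z ^ m‖) ∧
      padicEval ((V.formalSigma c ^ 2).subst (V.formalMul n)) z =
        padicEval (V.formalSigma c) (padicEval (V.formalMul n) z) ^ 2 := by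
  have hg := summable_norm_padicEval_of_isPadicInt (V.isPadicInt_formalMul n) (norm_lt_one_of_norm_le_inv_prime hz)
  obtain ⟨hsum, heval⟩ := padicEval_subst_eq_tsum (V.constantCoeff_formalMul n) hg
    (summable_double_formalSigma_sq_formalMul V hp hc hz n)
  refine ⟨hsum, ?_⟩
  rw [heval, ← (padicEval_formalSigma_sq_of_norm_le V hp hc (norm_padicEval_formalMul_le V n hz)).2]
  rfl

/-- **THE SQUARED DIVISION IDENTITY ON THE CLOSED DISC.** For a `p`-integral elliptic curve `V/ℚ_p`,
`p ≥ 3`, `‖c‖ ≤ 1`, `n ≥ 1` and `‖z‖ ≤ p⁻¹`: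
`z^{2(n²−1)} · σ_c([n](z))² = σ_c(z)^{2n²} · Pₙ(z)`, `Pₙ = sigmaSqDivisionRHS n = z^{2(n²−1)}ψₙ²(x(z))`
— Mazur–Tate's `σ(nQ)² = σ(Q)^{2n²}F_n(Q)²` for the member `σ_c` of the formal sigma family, at a
point of Bernardi's CLOSED disc. [Mazur–Tate 1991, Thm. 3.1; Silverman 2005, §5 Thm. 11 / Rem. 2]
[cite: MazurTate1991, Thm. 3.1] [cite: Silverman2005DivPoly, §5 Thm. 11] -/
theorem division_identity_at [V.IsElliptic] (hp : 3 ≤ p) {c : ℚ_[p]} (hc : ‖c‖ ≤ 1) {z : ℚ_[p]}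
    (hz : ‖z‖ ≤ (p : ℝ)⁻¹) {n : ℕ} (hn : 1 ≤ n) :
    z ^ (2 * (n ^ 2 - 1)) * padicEval (V.formalSigma c) (padicEval (V.formalMul n) z) ^ 2 =
      padicEval (V.formalSigma c) z ^ (2 * n ^ 2) * padicEval (V.sigmaSqDivisionRHS n) z := by
  obtain ⟨h0, h1, hodd, hODE⟩ := V.formalSigma_spec c
  have hid := V.sigmaSqDivisionIdentity_sq_of_satisfiesSigmaODE h0 h1 hodd hODE hn
  rw [SigmaSqDivisionIdentity] at hid
  have hz1 := norm_lt_one_of_norm_le_inv_prime hz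
  -- left-hand side
  obtain ⟨hXs, hXe⟩ := padicEval_X_pow z (2 * (n ^ 2 - 1))
  obtain ⟨hSs, hSe⟩ := padicEval_formalSigma_sq_subst_formalMul V hp hc hz n
  have hL := (padicEval_mul_of_summable_norm hXs hSs).2
  rw [hXe, hSe] at hL
  -- right-hand side
  obtain ⟨hSqs, hSqe⟩ := padicEval_formalSigma_sq_of_norm_le V hp hc hz
  obtain ⟨hSqps, hSqpe⟩ := padicEval_pow_of_summable_norm hSqs (n ^ 2)
  have hRs := summable_norm_padicEval_of_isPadicInt (V.isPadicInt_sum_ΨSq n) hz1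
  have hR := (padicEval_mul_of_summable_norm hSqps hRs).2
  rw [hSqpe, hSqe] at hR
  rw [← hL, hid, pow_mul]
  exact hR

end Disc

/-! ### §3 At a point of `E₁(ℚ_p)`: `σ_c(z(nP))² = σ_c(z(P))^{2n²}·ΨSqₙ(x(P))` -/

section Points

variable {p : ℕ} [Fact p.Prime] (V : WeierstrassCurve ℚ_[p]) [V.IsIntegral ℤ_[p]] [V.IsElliptic]

/-- **`σ_c(z(nP))² = σ_c(z(P))^{2n²} · ΨSqₙ(x(P))`** for `P = (x, y) ∈ E₁(ℚ_p)` (`‖x‖_p > 1`), `n ≥ 1`,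
`p ≥ 3`, `‖c‖ ≤ 1`: the division identity at `z = z(P) = −x/y` (`‖z‖ ≤ p⁻¹`), with `[n](z(P)) = z(nP)`
(`padicEval_formalMul_formalParameter`) and `Pₙ(z(P)) = z^{2(n²−1)}ΨSqₙ(x)` (`padicEval_sum_ΨSq`), the
factor `z^{2(n²−1)} ≠ 0` cancelled. [Mazur–Tate 1991, Thm. 3.1; Silverman 2005 §5 (18)]
[cite: MazurTate1991, Thm. 3.1] [cite: Silverman2005DivPoly, §5 Thm. 11] -/
theorem padicEval_formalSigma_nsmul_sq (hp : 3 ≤ p) {c : ℚ_[p]} (hc : ‖c‖ ≤ 1) {x y : ℚ_[p]}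
    (h : V.toAffine.Nonsingular x y) (hx : 1 < ‖x‖) {n : ℕ} (hn : 1 ≤ n) :
    padicEval (V.formalSigma c) (V.formalParameter (n • (.some x y h : V.toAffine.Point))) ^ 2 =
      padicEval (V.formalSigma c) (-x / y) ^ (2 * n ^ 2) * (V.ΨSq n).eval x := by
  have hz := norm_param_le_inv_prime V h.1 hx
  have hx0 : x ≠ 0 := fun h0 => by rw [h0, norm_zero] at hx; exact not_lt.mpr zero_le_one hx
  have hy0 : y ≠ 0 := fun h0 => by
    have := V.norm_formalParameter_sq h.1 hx
    rw [h0, div_zero, norm_zero, zero_pow two_ne_zero] at this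
    exact (inv_ne_zero (one_pos.trans hx).ne') this.symm
  have hz0 : -x / y ≠ 0 := div_ne_zero (neg_ne_zero.mpr hx0) hy0
  have hP : V.IsInReductionKernel (.some x y h) := (V.isInReductionKernel_some h).mpr hx
  have hid := division_identity_at V hp hc hz hn
  rw [← V.formalParameter_some h, V.padicEval_formalMul_formalParameter n hP, V.formalParameter_some h,
    sigmaSqDivisionRHS, V.padicEval_sum_ΨSq h.1 hx n hn, mul_left_comm] at hid
  exact mul_left_cancel₀ (pow_ne_zero _ hz0) hid

end Points

/-! ### §4 Rational points of a globally minimal `W/ℚ` -/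

section Rational

variable {p : ℕ} [Fact p.Prime] (W : WeierstrassCurve ℚ) [W.IsElliptic] [W.IsGloballyMinimal]

omit [W.IsElliptic] [W.IsGloballyMinimal] in
/-- The multiple `n • P` of a rational point and its image in `E(ℚ_p)`: for `nP = (x', y')`,
`z(n • ι P) = −x'/y'`. [folklore] -/
theorem formalParameter_nsmul_toPadicPoint {x y : ℚ} (h : W.toAffine.Nonsingular x y) {n : ℕ}
    {x' y' : ℚ} (h' : W.toAffine.Nonsingular x' y')
    (hn : n • (.some x y h : W.toAffine.Point) = .some x' y' h') :
    (W.baseChange ℚ_[p]).formalParameter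
        (n • (.some (x : ℚ_[p]) (y : ℚ_[p]) (nonsingular_ratCast h) : (W.baseChange ℚ_[p]).toAffine.Point)) =
      -(x' : ℚ_[p]) / (y' : ℚ_[p]) := by
  rw [← toPadicPoint_some (p := p) h, ← map_nsmul, hn, toPadicPoint_some, formalParameter_some]

/-- **`σ_c(z(nP))² = σ_c(z(P))^{2n²} · ΨSqₙ(x(P))` for rational points.** `W/ℚ` globally minimal,
`p ≥ 3`, `‖c‖ ≤ 1`, `P = (x, y) ∈ E(ℚ)` with `‖x‖_p > 1`, `n ≥ 1`, `nP = (x', y')`: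
`σ_c(−x'/y')² = σ_c(−x/y)^{2n²} · ΨSqₙ(x)` in `ℚ_p`. [Mazur–Tate 1991, Thm. 3.1; Mazur–Stein–Tate 2006,
§2] [cite: MazurTate1991, Thm. 3.1] [cite: MazurSteinTate2006, §2.7] -/
theorem padicEval_formalSigma_nsmul_sq_rat (hp : 3 ≤ p) {c : ℚ_[p]} (hc : ‖c‖ ≤ 1) {x y : ℚ}
    (h : W.toAffine.Nonsingular x y) (hx : 1 < ‖(x : ℚ_[p])‖) {n : ℕ} (hn : 1 ≤ n) {x' y' : ℚ}
    (h' : W.toAffine.Nonsingular x' y') (hmul : n • (.some x y h : W.toAffine.Point) = .some x' y' h') :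
    padicEval ((W.baseChange ℚ_[p]).formalSigma c) (-(x' : ℚ_[p]) / (y' : ℚ_[p])) ^ 2 =
      padicEval ((W.baseChange ℚ_[p]).formalSigma c) (-(x : ℚ_[p]) / (y : ℚ_[p])) ^ (2 * n ^ 2) *
        (((W.ΨSq n).eval x : ℚ) : ℚ_[p]) := by
  set V := W.baseChange ℚ_[p] with hVdef
  haveI : V.IsElliptic := by rw [hVdef]; infer_instance
  haveI : V.IsIntegral ℤ_[p] := by rw [hVdef]; infer_instance
  have key := padicEval_formalSigma_nsmul_sq V hp hc (nonsingular_ratCast (p := p) h) hx hn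
  rw [formalParameter_nsmul_toPadicPoint W h h' hmul] at key
  rw [key]
  congr 1
  have e := Polynomial.eval₂_at_apply (p := W.ΨSq n) (algebraMap ℚ ℚ_[p]) x
  rw [eq_ratCast, eq_ratCast] at e
  rw [← e, hVdef, baseChange, map_ΨSq, Polynomial.eval_map]

end Rational

end Summit.BirchSwinnertonDyer.BirchSwinnertonDyer.Theorems.PSSigmaLineFamilyDivision

end
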